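import Summits.QuantumFields.YangMills.Theses.SqueezedSkewness
import HarnessLib

/-!
# Route `SqueezedSkewness`, item `Assembly` (stmt-QuantumFields-25919) — CLOSED

`theorem squeezedSkewness_assembly_proof : Summit.QuantumFields.YangMills.Theses.SqueezedSkewness.Assembly`, i.e.
`PointlikeMirrorFloors → SqueezedFactorisation → BalabanLadder.NT`.  Landed VERBATIM (up to the style lint: merged
`intro`s, leading `unfold`) from the planner's kernel-checked crux workfile
`Cruxes/NT/Lines/squeezed_skewness_assembly.lean` (ym-idea-6 g2, commit 63e5c438a2e3; refuter re-check evidence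
`SqueezedAssemblyRecheck.lean` on the item).  Bookkeeping: X1 (`PointlikeMirrorFloors`) gives `(r, a, v, ε)` at the
radius `ρ` named by X2 (`SqueezedFactorisation`), X2 gives `(h, w, δ, σ)`; clause (i) of `LowerBounds` is X1's floor,
clause (ii) the triple `(v, θv, h)` with `ε₃ = (1−δ)·w·ε`, since `|Q3| ≥ |σ·w·Q2| − δ·w·Q2 = (1−δ)·w·Q2 ≥ (1−δ)·w·ε`.

R3/RECORD framing: route glue only — the line's open obligations remain `PointlikeMirrorFloors` (25918) and the
deciding `SqueezedFactorisation` (25917); NT and a fortiori the Yang–Mills mass gap are NOT proved here.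
-/

set_option autoImplicit false

namespace Summit.QuantumFields.YangMills.Theorems

open Literature.MathematicalPhysics.QuantumFieldTheory Literature.MathematicalPhysics.QuantumLattice
open Summit.QuantumFields.YangMills.Cruxes.OSLegsFromFemtoAndGap.DlrCollarTransfer
open Summit.QuantumFields.YangMills.Theses.SqueezedSkewness

/-- **Route `SqueezedSkewness`, item `Assembly` (stmt-QuantumFields-25919):**
`PointlikeMirrorFloors → SqueezedFactorisation → BalabanLadder.NT`.  From X1 the unit `(r, a)` and, at the radius `ρ`
of X2, the positive-time mode `v` with floor `ε`; from X2 the partner `h`, weight `w > 0`, squeeze `δ < 1` and sign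
`σ = ±1` with `|Q3(v, θv, h) − σ·w·Q2(θv, v)| ≤ δ·w·Q2(θv, v)`; clause (i) is the floor, clause (ii) the triple
`(v, θv, h)` with `ε₃ = (1−δ)·w·ε`.  Planner's proof (ym-idea-6 g2), re-landed. [folklore] -/
theorem squeezedSkewness_assembly_proof : Summit.QuantumFields.YangMills.Theses.SqueezedSkewness.Assembly := by
  unfold Summit.QuantumFields.YangMills.Theses.SqueezedSkewness.Assembly
  intro h1 h2 G _ _ _ _ hG
  letI : MeasurableSpace G := borel G
  haveI : BorelSpace G := ⟨rfl⟩
  obtain ⟨r, a, ha, ha0, hfl⟩ := h1 G hG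
  obtain ⟨ρ, hρ, hsq⟩ := h2 G hG r a ha ha0
  obtain ⟨v, hv0, hball, hpos, ε, β₅, Λ₅, hε, hfloor⟩ := hfl ρ hρ
  obtain ⟨h, d1, d2, d3, w, δ, σ, hw, hδ, hσ, β₆, Λ₆, hfac⟩ := hsq v hv0 hball ⟨ε, β₅, Λ₅, hε, hfloor⟩
  refine ⟨r, a, ha, ha0, ⟨v, ε, β₅, Λ₅, hpos, hε, hfloor⟩, ?_⟩
  refine ⟨v, thetaTest 4 v, h, (1 - δ) * w * ε, max β₅ β₆, max Λ₅ Λ₆, d1, d2, d3, ?_, ?_⟩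
  · have h1δ : 0 < 1 - δ := by linarith
    positivity
  · intro β hβ L hL
    have hβ5 : β₅ ≤ β := le_trans (le_max_left _ _) hβ
    have hβ6 : β₆ ≤ β := le_trans (le_max_right _ _) hβ
    have hL5 : Λ₅ ≤ a β * L := le_trans (le_max_left _ _) hL
    have hL6 : Λ₆ ≤ a β * L := le_trans (le_max_right _ _) hL
    have hF := hfloor β hβ5 L hL5
    have hA := hfac β hβ6 L hL6
    have h1δ : 0 < 1 - δ := by linarith
    have hwq : ε * w ≤ w * Q2 G r β L (a β) (thetaTest 4 v) v := by nlinarith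
    have key : (1 - δ) * (w * Q2 G r β L (a β) (thetaTest 4 v) v) ≤
        |Q3 G r β L (a β) v (thetaTest 4 v) h| := by
      have hA' := abs_le.mp hA
      rcases hσ with rfl | rfl
      · rw [le_abs]; left; nlinarith [hA'.1]
      · rw [le_abs]; right; nlinarith [hA'.2]
    calc (1 - δ) * w * ε = (1 - δ) * (ε * w) := by ring
      _ ≤ (1 - δ) * (w * Q2 G r β L (a β) (thetaTest 4 v) v) :=
          mul_le_mul_of_nonneg_left hwq h1δ.le
      _ ≤ _ := key

end Summit.QuantumFields.YangMills.Theorems
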